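import Summits.BirchSwinnertonDyer.Rank1Residual.F1Sign2.HondaSystemAtTwo
import Literature.NumberTheory.EllipticCurves.Sprung2012.ColemanMapJointCokernelProofs
import Literature.NumberTheory.EllipticCurves.Sprung2012.ColemanPairExistsProofs
import Literature.NumberTheory.EllipticCurves.Sprung2012.LocalTowerTraceProofs
import Literature.NumberTheory.EllipticCurves.Rank1Residual.Predicates
import HarnessLib

/-!
# D-imc-74 — the WRONSKIAN ROUTE to the blind generator at `p = 2`:
# (G) `HondaBlindGeneratorAtTwo` ⟸ (T0₂) no `2`-torsion in the local tower ∧ (IND₂) `c_{−1}, g·c_1` independent mod `2`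
# (kernel-checked port of the tree's odd-`p` cokernel criterion `Sprung2012.forall_exists_isColemanPair_X_mul_of_independent`)

Crux workfile for `stmt-BirchSwinnertonDyer-19097` (`SupersingularRankZeroAtTwo`; cell `bsd-f1-sign2`, planner seat
`-imc` g29; MEMO-imc §10.112-add5).  Companion of `D72BlindGenerator.lean` ((G) → (Y) → CDF±_H) and
`D73GeneratorRecipe.lean` ((G) ⟸ (G1) layerwise).  THIS FILE gives a SECOND, shorter sufficient condition for (G), by porting
to `p = 2` the Wronskian/Cramer architecture the tree already runs at odd `p`
(`Literature/…/Sprung2012/ColemanMapJointCokernelProofs.lean`: «`T·Λ² ⊆ Col(H¹_Iw)` from ONE point-independence clause»):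
since (G) is literally «`(T, 0)` is a Coleman value of some functional on `E(ℚ_{∞,v})`» (`IsColemanPair … z X 0`), it is the
case `(x, y) = (1, 0)` of «every `(T·x, T·y)` is a Coleman value».

## The port (what changes at `p = 2`)
* Coleman values EXIST for every functional (`exists_isColemanPair₂`): the tree's queue-sequence proof
  (`isQueueSequence_colemanTheta`, `Sprung2017.IsQueueSequence.exists_isChromaticLimit`) uses only the layer clause and the
  trace relations `Tr_{n+2/n+1} c_{n+2} = a c_{n+1} − c_n` (`n ≥ 0`), which `IsHondaSystemAtTwo` has verbatim — copied.
* Level `0`/`1` constants (`constantCoeff_eq₂`): with the relations AT TWO `c_0 = (a²−2a−1)c_{−1}`,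
  `Tr_{1/0}c_1 = a c_0 + (4−2a)c_{−1}` one gets `L♭(0) = −ε·z(c_{−1})`, `L♯(0) = −κ₁·z(c_{−1})` with `ε = a²−2a−1` ODD and
  `κ₁ = aε + 4 − 2a` EVEN (`a = a₂ ∈ {±2}`, or `0`).
* Wronskian (`wronskian₂`): for two functionals with Coleman values `(α, β)`, `(γ, δ)` the Wronskian `D = αδ − βγ` has
  `D(0) = 0` and `D'(0) ≡ ε·(ℓ₁σ₀ − ℓ₀σ₁) (mod 2)`, `ℓ_i = z_i(c_{−1})`, `σ_i = ∑_{j<2} j·z_i(gʲc_1) = z_i(g·c_1)` — only the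
  level-`1` linear term (`Sprung2012.IsColemanPair.natCast_dvd_coeff_one_sharp_add`, valid for every `p`) is needed, because
  `κ₁` is even; at odd `p` the level-`2` point `q` enters instead.
* Cramer (`forall_exists_isColemanPair_X_mul_of_det₂`): verbatim (`Λ`-linearity `Sprung2012.isColemanPair_lambdaSMul`).
* Two-point separation `Sprung2012.exists_addMonoidHom_pair_det_not_dvd`: verbatim (any `2`-torsion-free abelian group).
HENCE ★ `hondaBlindGeneratorAtTwo_of_noTwoTorsion_of_independent : (T0₂) → (IND₂) → (G)`, where
* (T0₂) `LocalTowerNoTwoTorsionAtTwo` — `E(ℚ_{∞,v})[2] = 0` for `W` good supersingular at `2` (TRUE: the non-zero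
  `2`-torsion of the height-`2` formal group has `t`-valuation `v(2)/3`, so lives only over fields with ramification index
  divisible by `3`, while `e(ℚ_{n,v}/ℚ₂) = 2ⁿ`; Newton polygon of `[2](t) = 2t − a₁t² − 2a₂t³ + (unit)t⁴ + …` with `2 ∣ a₁`.
  The tree's Lemma 2.3 (`Sprung2012.LocalTowerNoPTorsionProofs`) is `p ≠ 2` only (Silverman IV.6.1 needs `v(p) < p − 1`).)
* (IND₂) `HondaPairIndependentModTwoAtTwo` — `c_{−1}` and `g·c_1` are `𝔽₂`-independent modulo `2·E(ℚ_{∞,v})`: the exact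
  `p = 2` twin of the odd-`p` residual clause (IND) («a RANK statement which the dual-form generation clauses of the Honda
  predicate do not supply», loc. cit.); true in the model (`E(ℚ_{1,v})` free of rank `2` on `c_1, c_{−1}`), a level-`1` POINT
  statement — far smaller than the all-level rank input (G1b) of the layerwise recipe.
NET: CDF±_H ⟸ (T0₂) ∧ (IND₂) ∧ (Y) (with D72 ★), all typed; (Y) theorem-grade; (T0₂) textbook; (IND₂) the residual input.

NOT a proof of (G), (T0₂) or (IND₂).  No registry consequence.  BSD is proved here for no curve.

## References
* [Sprung2012] F. Sprung, J. Number Theory 132 (2012): Thm. 2.2, Lemma 2.3 (p. 1487), Def. 5.9 (p. 1495), Def. 7.2,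
  Props. 7.3/7.6 (pp. 1500–1501).
* [Kobayashi2003] S. Kobayashi, Invent. Math. 152 (2003), §8 (Honda theory at `2`: the relations at two).
* [KuriharaPollack2007] Prop. 1.2; [LeiSujatha2021] §3 (SES-KP) — the odd-`p` statement being ported.
* [Silverman2009] AEC IV.6.1, IV.6.4, VII.3 (torsion in formal groups; valuation of torsion points).
-/

set_option autoImplicit false
set_option linter.dupNamespace false
set_option linter.unusedVariables false

open scoped Classical NumberField
open NumberField IsDedekindDomain WeierstrassCurve Finset
open Literature.NumberTheory.EllipticCurves Literature.NumberTheory.EllipticCurves.Sprung2012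
  Literature.NumberTheory.EllipticCurves.Sprung2017 Literature.NumberTheory.EllipticCurves.Sprung2024
  Literature.NumberTheory.EllipticCurves.Rank1Residual Literature.NumberTheory.EllipticCurves.Kobayashi2003
  Literature.NumberTheory.GaloisRepresentations ZpExtension
open Summit.BirchSwinnertonDyer.Rank1Residual.F1Sign2

namespace Summit.BirchSwinnertonDyer.BirchSwinnertonDyer.Cruxes.SupersingularRankZeroAtTwo

namespace D74WronskianAtTwo

universe u

section Local

variable {K : Type u} [Field K] (κ : ZpExtension K 2) {E : Type u} [Field E] [Algebra K E]
  (ι : AlgebraicClosure K →ₐ[K] AlgebraicClosure E) (W : WeierstrassCurve K)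

variable {κ ι W}

/-! ## §1 Coleman values exist for every functional, AT TWO -/

/-- **`(P_{n,c_n}(z))_n` is an integral queue sequence at `2`** — port of `Sprung2012.isQueueSequence_colemanTheta`: only the
layer clause and the trace relations `Tr_{n+2/n+1}c_{n+2} = a c_{n+1} − c_n` of `IsHondaSystemAtTwo` are used.
[cite: Sprung2012, Thm. 2.2 (1) (p. 1487) and Prop. 5.5 (p. 1494)] [cite: Sprung2017, Def. 1.7] -/
theorem isQueueSequence_colemanTheta₂ {g : Field.absoluteGaloisGroup E}
    (hg : κ.IsTopGenerator (resGalOfEmb ι g)) {a : ℤ} {cneg : localPoints W E}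
    {c : ℕ → localPoints W E} (hH : IsHondaSystemAtTwo κ ι W a g cneg c)
    (z : localTowerPointsOfEmb κ ι W →+ ℤ_[2]) :
    IsQueueSequence 2 a (colemanTheta κ ι W g c z) := by
  intro n
  have hcn : ∀ k, c k ∈ localLayerPointsOfEmb κ ι W k := hH.2.1
  have hcT : ∀ k, c k ∈ localTowerPointsOfEmb κ ι W := fun k =>
    localLayerPointsOfEmb_le_localTowerPointsOfEmb κ ι W _ (hcn k)
  have htr : localTraceOfEmb κ ι W (n + 1) (n + 2) (c (n + 2)) = a • c (n + 1) - c n := by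
    have h := hH.2.2.2.2.1 (n + 1) (Nat.le_add_left 1 n)
    simpa only [Nat.add_sub_cancel] using h
  obtain ⟨q, hq⟩ := omega_dvd_thetaPoly_succ_sub κ ι W hg (hcn (n + 2)) z
  refine ⟨q, ?_⟩
  rw [colemanTheta_eq_thetaPoly, colemanTheta_eq_thetaPoly, colemanTheta_eq_thetaPoly,
    ← thetaPoly_succ_of_mem_layer κ ι W hg (hcn n), ← thetaPoly_zsmul κ ι W g (n + 1) (hcT (n + 1)),
    sub_add, ← thetaPoly_sub κ ι W g (n + 1) (zsmul_mem (hcT (n + 1)) a) (hcT n), ← htr]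
  exact hq

/-- **Every functional has a Coleman value, AT TWO** (`2 ∣ a`): port of `Sprung2012.exists_isColemanPair`.
[cite: Sprung2012, Prop. 3.9 (p. 1491), Prop. 5.3 and Def. 5.9 (pp. 1493–1495)] [cite: Sprung2017, Thm. 1.12] -/
theorem exists_isColemanPair₂ {g : Field.absoluteGaloisGroup E}
    (hg : κ.IsTopGenerator (resGalOfEmb ι g)) {a : ℤ} (ha : ((2 : ℕ) : ℤ) ∣ a)
    {cneg : localPoints W E} {c : ℕ → localPoints W E} (hH : IsHondaSystemAtTwo κ ι W a g cneg c)
    (z : localTowerPointsOfEmb κ ι W →+ ℤ_[2]) :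
    ∃ Lsharp Lflat : IwasawaAlgebra 2, IsColemanPair κ ι W a g c z Lsharp Lflat := by
  obtain ⟨Cs, Cf, h⟩ := (isQueueSequence_colemanTheta₂ hg hH z).exists_isChromaticLimit ha
  refine ⟨Cs, Cf, fun m => ?_⟩
  obtain ⟨Q, hQ⟩ := h m
  refine ⟨Q, ?_⟩
  rw [← coe_colemanTheta]
  exact hQ

/-! ## §2 Levels `0` and `1` with the relations AT TWO -/

/-- **Constant terms of a Coleman value, AT TWO**: `L♯(0) = −(a(a²−2a−1) + (4−2a))·z(c_{−1})` and
`L♭(0) = −(a²−2a−1)·z(c_{−1})` — port of `Sprung2012.IsColemanPair.constantCoeff_eq` with `c_0 = (a²−2a−1)c_{−1}`,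
`Tr_{1/0}c_1 = a c_0 + (4−2a)c_{−1}`. [cite: Kobayashi2003, §8 (relations at two)] [cite: Sprung2012, Def. 5.9, Def. 7.2] -/
theorem constantCoeff_eq₂ {a : ℤ} {g : Field.absoluteGaloisGroup E} (hg : κ.IsTopGenerator (resGalOfEmb ι g))
    {cneg : localPoints W E} {c : ℕ → localPoints W E} (hH : IsHondaSystemAtTwo κ ι W a g cneg c)
    {z : localTowerPointsOfEmb κ ι W →+ ℤ_[2]} {Ls Lf : IwasawaAlgebra 2} (hCP : IsColemanPair κ ι W a g c z Ls Lf) :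
    PowerSeries.constantCoeff Ls =
        -(((a : ℤ_[2]) * ((a : ℤ_[2]) ^ 2 - 2 * (a : ℤ_[2]) - 1) + (4 - 2 * (a : ℤ_[2]))) *
          evalOn W (localTowerPointsOfEmb κ ι W) z cneg) ∧
      PowerSeries.constantCoeff Lf =
        -(((a : ℤ_[2]) ^ 2 - 2 * (a : ℤ_[2]) - 1) * evalOn W (localTowerPointsOfEmb κ ι W) z cneg) := by
  have hcneg := hH.1
  have hc := hH.2.1
  have hc0 := hH.2.2.1
  have hTr1 := hH.2.2.2.1
  have hle := fun n ↦ localLayerPointsOfEmb_le_localTowerPointsOfEmb κ ι W n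
  rw [evalOn_of_mem W _ z (hle 0 hcneg)]
  set u : ℤ_[2] := z ⟨cneg, hle 0 hcneg⟩ with hu
  have hzc0 : z ⟨c 0, hle 0 (hc 0)⟩ = ((a : ℤ_[2]) ^ 2 - 2 * (a : ℤ_[2]) - 1) * u := by
    have e : (⟨c 0, hle 0 (hc 0)⟩ : localTowerPointsOfEmb κ ι W) = (a ^ 2 - 2 * a - 1) • ⟨cneg, hle 0 hcneg⟩ :=
      Subtype.ext (by rw [AddSubgroupClass.coe_zsmul]; exact hc0)
    rw [e, map_zsmul, zsmul_eq_mul]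
    push_cast
    ring
  have hTrmem0 : localTraceOfEmb κ ι W 0 1 (c 1) ∈ localLayerPointsOfEmb κ ι W 0 := by
    rw [hTr1]
    exact add_mem (AddSubgroup.zsmul_mem _ (hc 0) _) (AddSubgroup.zsmul_mem _ hcneg _)
  have hTrmem : localTraceOfEmb κ ι W 0 1 (c 1) ∈ localTowerPointsOfEmb κ ι W := hle 0 hTrmem0
  have hzTr : z ⟨localTraceOfEmb κ ι W 0 1 (c 1), hTrmem⟩ =
      (a : ℤ_[2]) * (((a : ℤ_[2]) ^ 2 - 2 * (a : ℤ_[2]) - 1) * u) + (4 - 2 * (a : ℤ_[2])) * u := by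
    have e : (⟨localTraceOfEmb κ ι W 0 1 (c 1), hTrmem⟩ : localTowerPointsOfEmb κ ι W) =
        a • ⟨c 0, hle 0 (hc 0)⟩ + (4 - 2 * a) • ⟨cneg, hle 0 hcneg⟩ :=
      Subtype.ext (by rw [AddMemClass.coe_add, AddSubgroupClass.coe_zsmul, AddSubgroupClass.coe_zsmul]; exact hTr1)
    rw [e, map_add, map_zsmul, map_zsmul, zsmul_eq_mul, zsmul_eq_mul, hzc0]
    push_cast
    ring
  have hsum : ∑ j ∈ range 2, evalOn W (localTowerPointsOfEmb κ ι W) z (g ^ j • c 1) =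
      z ⟨localTraceOfEmb κ ι W 0 1 (c 1), hTrmem⟩ := by
    have hmem : ∀ j : ℕ, g ^ j • c 1 ∈ localTowerPointsOfEmb κ ι W := fun j ↦
      smul_mem_localTowerPointsOfEmb κ ι W _ (hle 1 (hc 1))
    have h : (⟨localTraceOfEmb κ ι W 0 1 (c 1), hTrmem⟩ : localTowerPointsOfEmb κ ι W) =
        ∑ j ∈ range 2, ⟨g ^ j • c 1, hmem j⟩ := by
      apply Subtype.ext
      change localTraceOfEmb κ ι W 0 1 (c 1) =
        ((∑ j ∈ range 2, (⟨g ^ j • c 1, hmem j⟩ : localTowerPointsOfEmb κ ι W) :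
          localTowerPointsOfEmb κ ι W) : localPoints W E)
      rw [AddSubmonoidClass.coe_finsetSum, localTraceOfEmb_succ_eq_sum_pow_smul κ ι W hg 0 (hc 1)]
      refine sum_congr rfl fun j _ => ?_
      rw [pow_zero, one_mul]
    rw [h, map_sum]
    exact sum_congr rfl fun j _ => evalOn_of_mem W _ z (hmem j)
  constructor
  · have h := hCP 1
    rw [sharpPoly_one, flatPoly_one, map_one, map_zero, one_mul, zero_mul, add_zero] at h
    have h' := constantCoeff_eq_zero_of_toIwasawa_cyclotomicOmega_dvd h
    rw [map_add, constantCoeff_pairingSum, pow_one, hsum, hzTr] at h'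
    rw [eq_neg_of_add_eq_zero_right h']
    ring
  · have h := hCP 0
    rw [sharpPoly_zero, flatPoly_zero, map_zero, map_one, zero_mul, one_mul, zero_add] at h
    have h' := constantCoeff_eq_zero_of_toIwasawa_cyclotomicOmega_dvd h
    rw [map_add, constantCoeff_pairingSum] at h'
    simp only [pow_zero, sum_range_one, one_smul] at h'
    rw [evalOn_of_mem W _ z (hle 0 (hc 0)), hzc0] at h'
    exact eq_neg_of_add_eq_zero_right h'

/-! ## §3 The Wronskian of two Coleman values modulo `(2, T²)` and the Cramer criterion, AT TWO -/

private theorem coeff_one_mul₂ (φ ψ : IwasawaAlgebra 2) :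
    PowerSeries.coeff 1 (φ * ψ) =
      PowerSeries.constantCoeff φ * PowerSeries.coeff 1 ψ + PowerSeries.coeff 1 φ * PowerSeries.constantCoeff ψ := by
  rw [PowerSeries.coeff_mul, Nat.sum_antidiagonal_eq_sum_range_succ (fun i j => PowerSeries.coeff i φ * PowerSeries.coeff j ψ) 1,
    sum_range_succ, sum_range_one, Nat.sub_zero, Nat.sub_self, PowerSeries.coeff_zero_eq_constantCoeff_apply,
    PowerSeries.coeff_zero_eq_constantCoeff_apply]

private theorem padicInt_isUnit_iff_not_dvd₂ {x : ℤ_[2]} : IsUnit x ↔ ¬ (2 : ℤ_[2]) ∣ x := by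
  have h : IsUnit x ↔ ¬ ((2 : ℕ) : ℤ_[2]) ∣ x := by
    rw [PadicInt.isUnit_iff, ← PadicInt.norm_lt_one_iff_dvd, not_lt, le_antisymm_iff,
      and_iff_right (PadicInt.norm_le_one x)]
  simpa using h

private theorem exists_eq_X_mul_unit_of_constantCoeff_eq_zero₂ {D : IwasawaAlgebra 2}
    (h0 : PowerSeries.constantCoeff D = 0) (h1 : ¬ (2 : ℤ_[2]) ∣ PowerSeries.coeff 1 D) :
    ∃ u : (IwasawaAlgebra 2)ˣ, D = PowerSeries.X * (u : IwasawaAlgebra 2) := by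
  obtain ⟨D', hD'⟩ := PowerSeries.X_dvd_iff.mpr h0
  have hu : IsUnit D' := by
    rw [PowerSeries.isUnit_iff_constantCoeff, padicInt_isUnit_iff_not_dvd₂, ← PowerSeries.coeff_zero_eq_constantCoeff_apply,
      ← PowerSeries.coeff_succ_X_mul 0 D', ← hD']
    exact h1
  obtain ⟨u, rfl⟩ := hu
  exact ⟨u, hD'⟩

/-- **The Wronskian AT TWO.** For Coleman values `(α, β)` of `z₀` and `(γ, δ)` of `z₁` (Honda system at two, `2 ∣ a`), the
Wronskian `D = αδ − βγ` has `D(0) = 0`, and `2 ∣ D'(0) − ε·(ℓ₁σ₀ − ℓ₀σ₁)` with `ε = a² − 2a − 1`, `ℓ_i = z_i(c_{−1})`,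
`σ_i = ∑_{j<2} j·z_i(gʲc_1)` — from `constantCoeff_eq₂` (`L♯(0)` is an EVEN multiple of `ℓ`, so the unknown linear terms of
the flat values drop out mod `2`) and the level-`1` linear term `2 ∣ L♯'(0) + σ`
(`Sprung2012.IsColemanPair.natCast_dvd_coeff_one_sharp_add`, every `p`). [cite: Sprung2012, Def. 5.9 (p. 1495), Def. 7.2] -/
theorem wronskian₂ {a : ℤ} (ha : ((2 : ℕ) : ℤ) ∣ a) {g : Field.absoluteGaloisGroup E}
    (hg : κ.IsTopGenerator (resGalOfEmb ι g)) {cneg : localPoints W E} {c : ℕ → localPoints W E}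
    (hH : IsHondaSystemAtTwo κ ι W a g cneg c) {z₀ z₁ : localTowerPointsOfEmb κ ι W →+ ℤ_[2]} {α β γ δ : IwasawaAlgebra 2}
    (h₀ : IsColemanPair κ ι W a g c z₀ α β) (h₁ : IsColemanPair κ ι W a g c z₁ γ δ) :
    PowerSeries.constantCoeff (α * δ - β * γ) = 0 ∧
      (2 : ℤ_[2]) ∣ PowerSeries.coeff 1 (α * δ - β * γ) -
        ((a : ℤ_[2]) ^ 2 - 2 * (a : ℤ_[2]) - 1) *
          (evalOn W (localTowerPointsOfEmb κ ι W) z₁ cneg *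
              (∑ j ∈ range 2, (j : ℤ_[2]) * evalOn W (localTowerPointsOfEmb κ ι W) z₀ (g ^ j • c 1)) -
            evalOn W (localTowerPointsOfEmb κ ι W) z₀ cneg *
              (∑ j ∈ range 2, (j : ℤ_[2]) * evalOn W (localTowerPointsOfEmb κ ι W) z₁ (g ^ j • c 1))) := by
  obtain ⟨hα0, hβ0⟩ := constantCoeff_eq₂ hg hH h₀
  obtain ⟨hγ0, hδ0⟩ := constantCoeff_eq₂ hg hH h₁
  obtain ⟨xα, hxα⟩ := h₀.natCast_dvd_coeff_one_sharp_add
  obtain ⟨xγ, hxγ⟩ := h₁.natCast_dvd_coeff_one_sharp_add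
  obtain ⟨b', hb'⟩ := ha
  set ℓ₀ := evalOn W (localTowerPointsOfEmb κ ι W) z₀ cneg
  set ℓ₁ := evalOn W (localTowerPointsOfEmb κ ι W) z₁ cneg
  set σ₀ := ∑ j ∈ range 2, (j : ℤ_[2]) * evalOn W (localTowerPointsOfEmb κ ι W) z₀ (g ^ j • c 1)
  set σ₁ := ∑ j ∈ range 2, (j : ℤ_[2]) * evalOn W (localTowerPointsOfEmb κ ι W) z₁ (g ^ j • c 1)
  constructor
  · rw [map_sub, map_mul, map_mul, hα0, hβ0, hγ0, hδ0]
    ring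
  · rw [map_sub, coeff_one_mul₂, coeff_one_mul₂, hα0, hβ0, hγ0, hδ0, eq_sub_of_add_eq hxα, eq_sub_of_add_eq hxγ, hb']
    push_cast
    exact ⟨(b' * ((2 * (b' : ℤ_[2])) ^ 2 - 2 * (2 * (b' : ℤ_[2])) - 1) + 2 - 2 * b') *
        (ℓ₁ * PowerSeries.coeff 1 β - ℓ₀ * PowerSeries.coeff 1 δ)
        + ((2 * (b' : ℤ_[2])) ^ 2 - 2 * (2 * (b' : ℤ_[2])) - 1) * (ℓ₀ * xγ - ℓ₁ * xα), by ring⟩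

/-- **COKERNEL CRITERION AT TWO.** If two functionals `z₀, z₁` on `E(K_∞·K_v)` have
`z₀(c_{−1})·σ(z₁) − z₁(c_{−1})·σ(z₀) ∈ ℤ₂^×` (`σ(z) = ∑_{j<2} j·z(gʲc_1) = z(g·c_1)`), then the Wronskian of their Coleman
values is `T·(unit of Λ)`, and consequently **every `(T·x, T·y)` is a Coleman value** (Cramer's rule with the `Λ`-linearity
`Sprung2012.isColemanPair_lambdaSMul`) — port of `Sprung2012.IsColemanPair.forall_exists_isColemanPair_X_mul_of_det`.
[cite: Sprung2012, Def. 5.9 (p. 1495), Props. 7.3/7.6 (pp. 1500–1501)] [cite: KuriharaPollack2007, Prop. 1.2] -/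
theorem forall_exists_isColemanPair_X_mul_of_det₂ {a : ℤ} (ha : ((2 : ℕ) : ℤ) ∣ a)
    {g : Field.absoluteGaloisGroup E} (hg : κ.IsTopGenerator (resGalOfEmb ι g)) {cneg : localPoints W E}
    {c : ℕ → localPoints W E} (hH : IsHondaSystemAtTwo κ ι W a g cneg c) {z₀ z₁ : localTowerPointsOfEmb κ ι W →+ ℤ_[2]}
    {α β γ δ : IwasawaAlgebra 2} (h₀ : IsColemanPair κ ι W a g c z₀ α β) (h₁ : IsColemanPair κ ι W a g c z₁ γ δ)
    (hdet : ¬ (2 : ℤ_[2]) ∣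
      evalOn W (localTowerPointsOfEmb κ ι W) z₀ cneg *
          (∑ j ∈ range 2, (j : ℤ_[2]) * evalOn W (localTowerPointsOfEmb κ ι W) z₁ (g ^ j • c 1)) -
        evalOn W (localTowerPointsOfEmb κ ι W) z₁ cneg *
          (∑ j ∈ range 2, (j : ℤ_[2]) * evalOn W (localTowerPointsOfEmb κ ι W) z₀ (g ^ j • c 1))) :
    (∃ u : (IwasawaAlgebra 2)ˣ, α * δ - β * γ = PowerSeries.X * (u : IwasawaAlgebra 2)) ∧
      ∀ x y : IwasawaAlgebra 2, ∃ z : localTowerPointsOfEmb κ ι W →+ ℤ_[2],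
        IsColemanPair κ ι W a g c z (PowerSeries.X * x) (PowerSeries.X * y) := by
  obtain ⟨hD0, hD1⟩ := wronskian₂ ha hg hH h₀ h₁
  obtain ⟨b', hb'⟩ := ha
  have hε : ∀ t : ℤ_[2], (2 : ℤ_[2]) ∣ ((a : ℤ_[2]) ^ 2 - 2 * (a : ℤ_[2]) - 1) * t → (2 : ℤ_[2]) ∣ t := by
    intro t ht
    have e : t = 2 * ((2 * (b' : ℤ_[2]) ^ 2 - 2 * (b' : ℤ_[2])) * t) - ((a : ℤ_[2]) ^ 2 - 2 * (a : ℤ_[2]) - 1) * t := by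
      rw [hb']
      push_cast
      ring
    rw [e]
    exact dvd_sub (dvd_mul_right _ _) ht
  have hD1' : ¬ (2 : ℤ_[2]) ∣ PowerSeries.coeff 1 (α * δ - β * γ) := by
    intro h
    apply hdet
    have h2 := hε _ (by
      have := dvd_sub h hD1
      rwa [sub_sub_cancel] at this)
    rw [← dvd_neg]
    convert h2 using 1
    ring
  obtain ⟨u, hu⟩ := exists_eq_X_mul_unit_of_constantCoeff_eq_zero₂ hD0 hD1'
  refine ⟨⟨u, hu⟩, fun x y => ?_⟩
  set v : IwasawaAlgebra 2 := ↑u⁻¹ with hv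
  have hvu : v * (u : IwasawaAlgebra 2) = 1 := by rw [hv, Units.inv_mul]
  refine ⟨lambdaSMul κ ι W hg (v * (x * δ - y * γ)) z₀ + lambdaSMul κ ι W hg (v * (α * y - β * x)) z₁, ?_⟩
  have h := (isColemanPair_lambdaSMul hg hH.2.1 h₀ (v * (x * δ - y * γ))).add
    (isColemanPair_lambdaSMul hg hH.2.1 h₁ (v * (α * y - β * x)))
  have e1 : v * (x * δ - y * γ) * α + v * (α * y - β * x) * γ = PowerSeries.X * x := by
    rw [show v * (x * δ - y * γ) * α + v * (α * y - β * x) * γ = v * ((α * δ - β * γ) * x) by ring, hu,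
      show v * (PowerSeries.X * ↑u * x) = (v * ↑u) * (PowerSeries.X * x) by ring, hvu, one_mul]
  have e2 : v * (x * δ - y * γ) * β + v * (α * y - β * x) * δ = PowerSeries.X * y := by
    rw [show v * (x * δ - y * γ) * β + v * (α * y - β * x) * δ = v * ((α * δ - β * γ) * y) by ring, hu,
      show v * (PowerSeries.X * ↑u * y) = (v * ↑u) * (PowerSeries.X * y) by ring, hvu, one_mul]
  rwa [e1, e2] at h

/-- **`T·Λ²` consists of Coleman values, AT TWO, from (no `2`-torsion) + (`c_{−1}, g·c_1` independent mod `2`)** — port of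
`Sprung2012.forall_exists_isColemanPair_X_mul_of_independent` (two-point Pontryagin separation
`Sprung2012.exists_addMonoidHom_pair_det_not_dvd`, verbatim). [cite: Sprung2012, Thm. 2.2, Lemma 2.3, Def. 5.9, §7.1] -/
theorem forall_exists_isColemanPair_X_mul_of_independent₂ {a : ℤ} (ha : ((2 : ℕ) : ℤ) ∣ a)
    {g : Field.absoluteGaloisGroup E} (hg : κ.IsTopGenerator (resGalOfEmb ι g)) {cneg : localPoints W E}
    {c : ℕ → localPoints W E} (hH : IsHondaSystemAtTwo κ ι W a g cneg c)
    (hN : ∀ P : localPoints W E, P ∈ localTowerPointsOfEmb κ ι W → 2 • P = 0 → P = 0)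
    (hind : ∀ (m₀ m₁ : ℤ) (y : localPoints W E), y ∈ localTowerPointsOfEmb κ ι W →
      2 • y = m₀ • cneg + m₁ • (g • c 1) → (2 : ℤ) ∣ m₀ ∧ (2 : ℤ) ∣ m₁) :
    ∀ x y : IwasawaAlgebra 2, ∃ z : localTowerPointsOfEmb κ ι W →+ ℤ_[2],
      IsColemanPair κ ι W a g c z (PowerSeries.X * x) (PowerSeries.X * y) := by
  have hle := fun n ↦ localLayerPointsOfEmb_le_localTowerPointsOfEmb κ ι W n
  have hq : g • c 1 ∈ localTowerPointsOfEmb κ ι W := smul_mem_localTowerPointsOfEmb κ ι W _ (hle 1 (hH.2.1 1))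
  set x₁ : localTowerPointsOfEmb κ ι W := ⟨cneg, hle 0 hH.1⟩ with hx₁
  set x₂ : localTowerPointsOfEmb κ ι W := ⟨g • c 1, hq⟩ with hx₂
  have hN' : ∀ y : localTowerPointsOfEmb κ ι W, (2 : ℕ) • y = 0 → y = 0 := fun y hy ↦
    Subtype.ext (hN y y.2 (by rw [← AddSubmonoidClass.coe_nsmul, hy]; rfl))
  have hind' : ∀ (m₁ m₂ : ℤ) (y : localTowerPointsOfEmb κ ι W), (2 : ℕ) • y = m₁ • x₁ + m₂ • x₂ →
      ((2 : ℕ) : ℤ) ∣ m₁ ∧ ((2 : ℕ) : ℤ) ∣ m₂ := fun m₁ m₂ y hy ↦ by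
    have h := hind m₁ m₂ y y.2 (by
      have h := congrArg (fun t : localTowerPointsOfEmb κ ι W ↦ (t : localPoints W E)) hy
      simpa only [AddSubmonoidClass.coe_nsmul, AddMemClass.coe_add, AddSubgroupClass.coe_zsmul] using h)
    exact_mod_cast h
  obtain ⟨z₀, z₁, hdet⟩ := exists_addMonoidHom_pair_det_not_dvd hN' hind'
  obtain ⟨α, β, h₀⟩ := exists_isColemanPair₂ hg ha hH z₀
  obtain ⟨γ, δ, h₁⟩ := exists_isColemanPair₂ hg ha hH z₁
  refine (forall_exists_isColemanPair_X_mul_of_det₂ ha hg hH h₀ h₁ ?_).2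
  have hσ : ∀ z : localTowerPointsOfEmb κ ι W →+ ℤ_[2],
      ∑ j ∈ range 2, (j : ℤ_[2]) * evalOn W (localTowerPointsOfEmb κ ι W) z (g ^ j • c 1) = z x₂ := by
    intro z
    rw [sum_range_succ, sum_range_one]
    simp only [Nat.cast_zero, zero_mul, zero_add, Nat.cast_one, one_mul, pow_one]
    exact evalOn_of_mem W _ z hq
  rw [hσ, hσ, evalOn_of_mem W _ z₀ (hle 0 hH.1), evalOn_of_mem W _ z₁ (hle 0 hH.1)]
  have e2 : ((2 : ℕ) : ℤ_[2]) = 2 := by norm_num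
  rw [e2] at hdet
  exact hdet

end Local

/-! ## §4 The two inputs, typed, and (G) from them -/

section Inputs

open Summit.BirchSwinnertonDyer.BirchSwinnertonDyer.Cruxes.SupersingularRankZeroAtTwo

/-- **(T0₂) `LocalTowerNoTwoTorsionAtTwo`** — Lemma 2.3 AT TWO: for `W/ℚ` globally minimal with good supersingular
reduction at `2`, the local cyclotomic `ℤ₂`-tower `E(ℚ_{∞,v})` (`v ∣ 2`) has no point of order `2`.  TRUE (textbook): a
non-zero `2`-torsion point of the height-`2` formal group has `t`-valuation `v(2)/3` (Newton polygon of `[2](t)`, using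
`2 ∣ a₁` for a minimal model supersingular at `2`), so it is rational only over fields whose ramification index is divisible
by `3`, and `e(ℚ_{n,v}/ℚ₂) = 2ⁿ`; all `2`-power torsion of `E` over a `2`-adic field with supersingular reduction lies in the
formal group.  The tree's `Sprung2012.lem23_localTowerPoints_noPTorsion` is stated for `p ≠ 2` only.  Nothing asserted.
[cite: Silverman2009, IV.6.1, VII.3.1] [cite: Sprung2012, Lemma 2.3 (p. 1487)] -/
def LocalTowerNoTwoTorsionAtTwo : Prop :=
  ∀ (W : WeierstrassCurve ℚ) [W.IsElliptic] [W.IsGloballyMinimal],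
  GoodSS W 2 →
  ∀ (κ : ZpExtension ℚ 2), κ.IsCyclotomic →
  ∀ (v : HeightOneSpectrum (𝓞 ℚ)), (2 : 𝓞 ℚ) ∈ v.asIdeal →
  ∀ P : localPoints W (v.adicCompletion ℚ),
    P ∈ localTowerPointsOfEmb κ (closureEmb (K := ℚ) (v.adicCompletion ℚ)) W → 2 • P = 0 → P = 0

/-- **(IND₂) `HondaPairIndependentModTwoAtTwo`** — the residual POINT input at `p = 2`: for the line's local Honda data
`(g, c)` at `v ∣ 2` (`a₂ ≠ 0`) and any bottom point `c_{−1}` making it a Honda system at two, the points `c_{−1}` and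
`g·c_1` are `𝔽₂`-independent modulo `2·E(ℚ_{∞,v})`: `2y = m₀c_{−1} + m₁(g·c_1)` with `y` in the tower forces `2 ∣ m₀, m₁`.
The exact `p = 2` twin of the clause (IND) of `Sprung2012.forall_exists_isColemanPair_X_mul_of_independent` (there the
level-`2` point `q`; here level `1` suffices because `L♯(0)` is even).  True in the model: `E(ℚ_{1,v})` is free of rank
`2 = [ℚ_{1,v} : ℚ₂]` on `c_1, c_{−1}` (`Tr c_1 = −2c_{−1}` at `a₂ = 2`, `= −6c_{−1}` at `a₂ = −2`), a RANK statement the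
dual-form clauses of `IsHondaSystemAtTwo` do not supply.  Nothing asserted. [cite: Sprung2012, Thm. 2.2, Lemma 2.3, Cor. 2.10]
[cite: Kobayashi2003, §8] -/
def HondaPairIndependentModTwoAtTwo : Prop :=
  ∀ (W : WeierstrassCurve ℚ) [W.IsElliptic] [W.IsGloballyMinimal],
  GoodSS W 2 → W.frobeniusTrace 2 ≠ 0 →
  ∀ (κ : ZpExtension ℚ 2), κ.IsCyclotomic →
  ∀ (v : HeightOneSpectrum (𝓞 ℚ)), (2 : 𝓞 ℚ) ∈ v.asIdeal →
  ∀ (g : Field.absoluteGaloisGroup (v.adicCompletion ℚ)) (c : ℕ → localPoints W (v.adicCompletion ℚ)),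
    κ.IsTopGenerator (resGalOfEmb (closureEmb (K := ℚ) (v.adicCompletion ℚ)) g) →
    (∀ n, c n ∈ localLayerPointsOfEmb κ (closureEmb (K := ℚ) (v.adicCompletion ℚ)) W n) →
    ∀ cneg : localPoints W (v.adicCompletion ℚ),
      IsHondaSystemAtTwo κ (closureEmb (K := ℚ) (v.adicCompletion ℚ)) W (W.frobeniusTrace 2) g cneg c →
    ∀ (m₀ m₁ : ℤ) (y : localPoints W (v.adicCompletion ℚ)),
      y ∈ localTowerPointsOfEmb κ (closureEmb (K := ℚ) (v.adicCompletion ℚ)) W →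
      2 • y = m₀ • cneg + m₁ • (g • c 1) → (2 : ℤ) ∣ m₀ ∧ (2 : ℤ) ∣ m₁

/-- **(G) `HondaBlindGeneratorAtTwo`** — VERBATIM copy of `D72BlindGenerator.HondaBlindGeneratorAtTwo` /
`D73GeneratorRecipe.HondaBlindGeneratorAtTwo` (crux workfiles are not importable from one another; the three definitions are
syntactically identical, so the ★ theorems compose definitionally): some functional on `E(ℚ_{∞,v})` has Coleman value
`(T, 0)`.  Nothing asserted. [cite: Sprung2012, Def. 5.9 (p. 1495), Open Problem 7.22 (p. 1505)] -/
def HondaBlindGeneratorAtTwo : Prop :=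
  ∀ (W : WeierstrassCurve ℚ) [W.IsElliptic] [W.IsGloballyMinimal],
  GoodSS W 2 → W.frobeniusTrace 2 ≠ 0 →
  ∀ (κ : ZpExtension ℚ 2), κ.IsCyclotomic →
  ∀ (v : HeightOneSpectrum (𝓞 ℚ)), (2 : 𝓞 ℚ) ∈ v.asIdeal →
  ∀ (g : Field.absoluteGaloisGroup (v.adicCompletion ℚ)) (c : ℕ → localPoints W (v.adicCompletion ℚ)),
    κ.IsTopGenerator (resGalOfEmb (closureEmb (K := ℚ) (v.adicCompletion ℚ)) g) →
    (∀ n, c n ∈ localLayerPointsOfEmb κ (closureEmb (K := ℚ) (v.adicCompletion ℚ)) W n) →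
    (∃ cneg : localPoints W (v.adicCompletion ℚ),
      Summit.BirchSwinnertonDyer.Rank1Residual.F1Sign2.IsHondaSystemAtTwo κ (closureEmb (K := ℚ) (v.adicCompletion ℚ)) W
        (W.frobeniusTrace 2) g cneg c) →
    ∃ z : localTowerPointsOfEmb κ (closureEmb (K := ℚ) (v.adicCompletion ℚ)) W →+ ℤ_[2],
      IsColemanPair κ (closureEmb (K := ℚ) (v.adicCompletion ℚ)) W (W.frobeniusTrace 2) g c z PowerSeries.X 0

/-- ★★ **(G) from (T0₂) and (IND₂)** — the Wronskian route, kernel-checked: `(T, 0) = (T·1, T·0)` is a Coleman value by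
`forall_exists_isColemanPair_X_mul_of_independent₂`; `2 ∣ a₂` is the second conjunct of `GoodSS W 2`.
[cite: Sprung2012, Def. 5.9, Props. 7.3/7.6, Open Problem 7.22] -/
theorem hondaBlindGeneratorAtTwo_of_noTwoTorsion_of_independent
    (hT : LocalTowerNoTwoTorsionAtTwo) (hI : HondaPairIndependentModTwoAtTwo) : HondaBlindGeneratorAtTwo := by
  intro W _ _ hss ha κ hκ v hv g c hg hc hex
  obtain ⟨cneg, hH⟩ := hex
  obtain ⟨z, hz⟩ := forall_exists_isColemanPair_X_mul_of_independent₂ hss.2 hg hH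
    (fun P hP h2 ↦ hT W hss κ hκ v hv P hP h2)
    (fun m₀ m₁ y hy h ↦ hI W hss ha κ hκ v hv g c hg hc cneg hH m₀ m₁ y hy h) 1 0
  exact ⟨z, by simpa using hz⟩

end Inputs

end D74WronskianAtTwo

end Summit.BirchSwinnertonDyer.BirchSwinnertonDyer.Cruxes.SupersingularRankZeroAtTwo
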